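import Mathlib.LinearAlgebra.Matrix.ToLinearEquiv
import Mathlib.LinearAlgebra.Matrix.NonsingularInverse
import Literature.NumberTheory.Transcendental.RoySmallValueEstimatesRegularSeqProofs
import Literature.NumberTheory.Transcendental.RoySmallValueEstimatesResultantKProofs
import Literature.NumberTheory.Transcendental.RoySmallValueEstimatesDeterminantProofs
import HarnessLib

/-!
# Small value estimates at rational translates (Nguyen–Roy 2016) — proofs, XV: the determinant `Φ` of a decomposition, over any field

Fifteenth proofs file towards `Literature.NumberTheory.Transcendental.nguyenRoy2016_thm_1` (Nguyen–Roy,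
IJNT 12 (2016) = arXiv:1412.5163): the engine of Roy's multiplicity estimate (Mathematika 59
(2013) = arXiv:1301.0663, proof of Theorem 5.2) in the generality in which that proof uses it.
File XIII built the determinant `Φ` over `ℚ` for the pure powers; here, over an arbitrary field
`K` of characteristic zero and for ANY decomposition data `𝒟 : NguyenRoyK.DecompData K m D ν P`
(subspaces `E_j ⊆ K[x]_{ν−D}`, `dim E_m = D^m`, `K[x]_ν = ⊕ E_j P_j` uniquely — the output of
Lemma 5.1 for a regular sequence `P`, `NguyenRoy.exists_decomp_of_regular`; for Theorem 5.2 proper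
`P₀, …, P_{m−1}` will be taken inside `I_D`):

* `DecompData.genMat`, **`DecompData.detPhi 𝒟 = Φ ∈ K[u]`**, `coeff_Gvec` (under any specialisation
  `q`, `M(q)v` is the coefficient vector of `∑ v_{jk} b_{jk} Q_j`), **`detPhi_ne_zero`**
  (`Φ(P) ≠ 0`, via `specForm_coeff : P_i = ∑_j [x^{α_j}]P_i x^{α_j}` and the uniqueness in `𝒟`),
  **`blockDeg_detPhi : deg_{u_i} Φ = dim E_i`** (Roy: "multihomogeneous … homogeneous of degree `D^m`
  in the last component");
* **`resD_dvd_detPhi : Res_D ∣ Φ`** in `K[u]` — at the generic point of `Res_D = 0` (in an algebraic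
  closure of `Frac(K[u]/(Res_D))`, `Res_D` being prime over `K` by file XIV) the forms have a
  common projective zero (zeros theorem of file XIV), so `φ_Q` misses `x_k^ν` and `Φ = 0` there;
* `ideg_veroIdeal_le_of_decompData`, and with the pure-power data `purePowData` (Lemma 5.1, files
  X/XII) and the lower bound of file XIV: **`NguyenRoyK.ideg_veroIdeal_eq : deg 𝔙_D = D^m`**,
  **`NguyenRoyK.blockDeg_resD_eq : deg_{u_i} Res_D = D^m`** over any field of characteristic zero.

Definitions are the objects of the proof (with bodies); `DecompData` is a structure packaging the
conclusion of Lemma 5.1; no named facts.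

## References

* [Roy2013] D. Roy, *A small value estimate for 𝔾ₐ × 𝔾ₘ*, Mathematika 59 (2013) = arXiv:1301.0663,
  §5: Lemma 5.1, Theorem 5.2 and its proof (pp. 13–14 of the arXiv text).
* [NesterenkoPhilippon2001] Yu. V. Nesterenko, P. Philippon (eds.), LNM 1752 (2001), Ch. 3 §4,
  Def. 4.3–4.5, Prop. 4.4 (p. 38).
* [NguyenRoy2016] N. A. V. Nguyen, D. Roy, IJNT 12 (2016) = arXiv:1412.5163, §4.
-/

noncomputable section

open MvPolynomial Finset

attribute [local instance] MvPolynomial.gradedAlgebra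

namespace Literature.NumberTheory.Transcendental

namespace NguyenRoyK

open NguyenRoy (MonoIdx monoIdxEquivSym fintypeMonoIdx card_monoIdx veroN veroN_succ veroEquiv vexp
  degree_vexp vidx vexp_vidx vexp_injective nuD nuD_spec specForm isHomogeneous_specForm aeval_specForm
  eq_zero_of_forall_coeff)

attribute [local instance] NguyenRoy.fintypeMonoIdx

/-! ## R2013 Theorem 5.2's determinant `Φ` attached to a decomposition `K[x]_ν = ⊕ E_j P_j` -/

section PhiK

attribute [local instance] NguyenRoy.finiteDimensional_homogeneousSubmodule

variable {K : Type*} [Field K] {m D ν : ℕ} {P : ℕ → MvPolynomial (Fin (m + 1)) K}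

variable (K m D ν P) in
/-- **The data of R2013 Lemma 5.1**: subspaces `E₀, …, E_m ⊆ K[x]_{ν−D}` with `dim E_m = D^m` such
that every `F ∈ K[x]_ν` is uniquely `∑ Q_j P_j` with `Q_j ∈ E_j` (`K[x]_ν = E₀P₀ ⊕ ⋯ ⊕ E_mP_m`).
For a regular sequence `P₀, …, P_m` of forms of degree `D` and `ν ≥ (m+1)D − m` such data exist
(`NguyenRoy.exists_decomp_of_regular`, file X). [cite: Roy2013, Lemma 5.1] -/
structure DecompData where
  /-- the subspaces `E_j` -/
  E : Fin (m + 1) → Submodule K (MvPolynomial (Fin (m + 1)) K)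
  /-- `E_j ⊆ K[x]_{ν−D}` -/
  le : ∀ j, E j ≤ homogeneousSubmodule (Fin (m + 1)) K (ν - D)
  /-- `dim E_m = D^m` -/
  finrank_last : Module.finrank K (E (Fin.last m)) = D ^ m
  /-- `K[x]_ν = ⊕ E_j P_j`: unique decomposition -/
  unique : ∀ F ∈ homogeneousSubmodule (Fin (m + 1)) K ν,
    ∃! Q : Fin (m + 1) → MvPolynomial (Fin (m + 1)) K, (∀ j : Fin (m + 1), Q j ∈ E j) ∧ ∑ j, Q j * P j = F

variable (K m D) in
/-- **Lemma 5.1 for the pure powers** `x₀^D, …, x_m^D` in degree `ν = (m+1)D − m` (`D ≥ 1`): a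
`DecompData`. [cite: Roy2013, Lemma 5.1] -/
def purePowData (hD : 1 ≤ D) : DecompData K m D (nuD m D) (NguyenRoy.purePow m D) :=
  let h := NguyenRoy.exists_decomp_of_regular hD (NguyenRoy.purePow (K := K) m D)
    (NguyenRoy.isHomogeneous_purePow m D)
    (fun j hj F hF => NguyenRoy.purePow_regular m D j hj F hF) (nuD_spec hD).1
  { E := h.choose
    le := h.choose_spec.1
    finrank_last := h.choose_spec.2.1
    unique := h.choose_spec.2.2 }

namespace DecompData

variable (𝒟 : DecompData K m D ν P)

/-- The `E_j` are finite-dimensional. [folklore] -/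
instance finiteDimensional_E (j : Fin (m + 1)) : FiniteDimensional K (𝒟.E j) :=
  Submodule.finiteDimensional_of_le (𝒟.le j)

/-- `d_j = dim E_j`. [cite: Roy2013, proof of Theorem 5.2] -/
def dimE (j : Fin (m + 1)) : ℕ := Module.finrank K (𝒟.E j)

/-- `d_m = D^m`. [cite: Roy2013, Lemma 5.1] -/
theorem dimE_last : 𝒟.dimE (Fin.last m) = D ^ m := 𝒟.finrank_last

/-- A basis of `E_j`. [folklore] -/
def basisE (j : Fin (m + 1)) : Module.Basis (Fin (𝒟.dimE j)) K (𝒟.E j) := Module.finBasis K (𝒟.E j)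

/-- The column index: pairs `(j, k)`, `k < d_j` (the basis `𝒜` of `E₀ × ⋯ × E_m`).
[cite: Roy2013, proof of Theorem 5.2] -/
abbrev ColIdx : Type := Σ j : Fin (m + 1), Fin (𝒟.dimE j)

/-- The basis vectors `b_{j,k} ∈ E_j ⊆ K[x]_{ν−D}` as polynomials. [folklore] -/
def bvec (c : 𝒟.ColIdx) : MvPolynomial (Fin (m + 1)) K := (𝒟.basisE c.1 c.2 : MvPolynomial (Fin (m + 1)) K)

/-- `b_{j,k} ∈ E_j`. [folklore] -/
theorem bvec_mem (c : 𝒟.ColIdx) : 𝒟.bvec c ∈ 𝒟.E c.1 := (𝒟.basisE c.1 c.2).2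

/-- `b_{j,k} ∈ K[x]_{ν−D}`. [folklore] -/
theorem isHomogeneous_bvec (c : 𝒟.ColIdx) : (𝒟.bvec c).IsHomogeneous (ν - D) :=
  𝒟.le c.1 (𝒟.bvec_mem c)

variable {𝒟}

/-- `∑ Q_j P_j ∈ K[x]_ν` for `Q_j ∈ E_j` (`P_j ∈ K[x]_D`, `D ≤ ν`). [folklore] -/
theorem sum_mul_mem (hP : ∀ j, (P j).IsHomogeneous D) (hDν : D ≤ ν)
    (Q : (j : Fin (m + 1)) → 𝒟.E j) :
    ∑ j, (Q j : MvPolynomial (Fin (m + 1)) K) * P j ∈ homogeneousSubmodule (Fin (m + 1)) K ν := by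
  refine Submodule.sum_mem _ fun j _ => ?_
  have h := (𝒟.le j (Q j).2 : ((Q j : MvPolynomial (Fin (m + 1)) K)).IsHomogeneous _).mul (hP j)
  rwa [Nat.sub_add_cancel hDν] at h

/-- **`∑ d_j = dim K[x]_ν`**: `(Q_j) ↦ ∑ Q_j P_j` is an isomorphism `E₀ × ⋯ × E_m ≅ K[x]_ν`, so the
column and row index types have the same cardinality. [cite: Roy2013, proof of Theorem 5.2] -/
theorem card_colIdx (hP : ∀ j, (P j).IsHomogeneous D) (hDν : D ≤ ν) :
    Fintype.card 𝒟.ColIdx = Fintype.card (MonoIdx m ν) := by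
  classical
  let ψ₀ : ((j : Fin (m + 1)) → 𝒟.E j) →ₗ[K] MvPolynomial (Fin (m + 1)) K :=
    ∑ j : Fin (m + 1), (LinearMap.mulRight K (P j)).comp ((𝒟.E j).subtype.comp (LinearMap.proj j))
  have hψ₀ : ∀ Q, ψ₀ Q = ∑ j, (Q j : MvPolynomial (Fin (m + 1)) K) * P j := fun Q => by
    simp [ψ₀, LinearMap.sum_apply]
  let ψ := LinearMap.codRestrict (homogeneousSubmodule (Fin (m + 1)) K ν) ψ₀
    (fun Q => by rw [hψ₀]; exact sum_mul_mem hP hDν Q)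
  have hψ : ∀ Q, (ψ Q : MvPolynomial (Fin (m + 1)) K) = ∑ j, (Q j : MvPolynomial (Fin (m + 1)) K) * P j :=
    fun Q => by rw [LinearMap.codRestrict_apply, hψ₀]
  have hinj : Function.Injective ψ := by
    intro Q Q' h
    have h' := congrArg Subtype.val h
    rw [hψ, hψ] at h'
    have hu := (𝒟.unique _ (sum_mul_mem hP hDν Q)).unique ⟨fun j => (Q j).2, rfl⟩
      ⟨fun j => (Q' j).2, h'.symm⟩
    funext j
    exact Subtype.ext (congrFun hu j)
  have hsurj : Function.Surjective ψ := by
    rintro ⟨F, hF⟩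
    obtain ⟨Q, ⟨hQ, hQF⟩, -⟩ := 𝒟.unique F hF
    refine ⟨fun j => ⟨Q j, hQ j⟩, Subtype.ext ?_⟩
    rw [hψ]
    exact hQF
  have e := LinearEquiv.ofBijective ψ ⟨hinj, hsurj⟩
  have h1 := e.finrank_eq
  rw [Module.finrank_pi_fintype, NguyenRoy.finrank_homogeneousSubmodule_eq_choose] at h1
  rw [Fintype.card_sigma, card_monoIdx, ← h1]
  simp only [Fintype.card_fin]
  rfl

/-- An identification of the columns with the rows (monomials of degree `ν`). [folklore] -/
def colEquiv (hP : ∀ j, (P j).IsHomogeneous D) (hDν : D ≤ ν) : 𝒟.ColIdx ≃ MonoIdx m ν :=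
  Fintype.equivOfCardEq (card_colIdx hP hDν)

/-! ### The generic matrix and its determinant -/

variable (𝒟) in
/-- The entry of the generic matrix at row `γ` and column `(j, k)`:
`∑_{j'} u_{j,j'} · [x^γ](b_{j,k} x^{α_{j'}})`, the `x^γ`-coefficient of `b_{j,k} · 𝐐_j` for the
generic form `𝐐_j = ∑_{j'} u_{j,j'} x^{α_{j'}}`. [cite: Roy2013, proof of Theorem 5.2] -/
def genEntry (γ : Fin (m + 1) →₀ ℕ) (c : 𝒟.ColIdx) :
    MvPolynomial (Fin (m + 1) × Fin (veroN m D + 1)) K :=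
  ∑ j' : Fin (veroN m D + 1), C (coeff γ (𝒟.bvec c * monomial (vexp m D j') 1)) * X (c.1, j')

/-- **The matrix `M_𝐐`** of `φ_𝐐 : E₀ × ⋯ × E_m → K[x]_ν`, `(A_j) ↦ ∑ A_j 𝐐_j`, for the generic
forms `𝐐_j`, in the bases `(b_{j,k})` and `(x^γ)_{|γ| = ν}`. [cite: Roy2013, proof of Theorem 5.2] -/
def genMat (hP : ∀ j, (P j).IsHomogeneous D) (hDν : D ≤ ν) :
    Matrix (MonoIdx m ν) (MonoIdx m ν) (MvPolynomial (Fin (m + 1) × Fin (veroN m D + 1)) K) :=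
  fun γ ρ => 𝒟.genEntry γ.1 ((colEquiv hP hDν).symm ρ)

/-- **`Φ = det M_𝐐 ∈ K[u]`.** [cite: Roy2013, proof of Theorem 5.2] -/
def detPhi (hP : ∀ j, (P j).IsHomogeneous D) (hDν : D ≤ ν) :
    MvPolynomial (Fin (m + 1) × Fin (veroN m D + 1)) K :=
  (genMat (𝒟 := 𝒟) hP hDν).det

/-! ### Specialisation -/

section Spec

variable {L : Type*} [CommRing L]

/-- A form of degree `D` over `K` is the specialisation at its own coefficient vector:
`P = ∑_j [x^{α_j}]P · x^{α_j}`. [folklore] -/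
theorem specForm_coeff {R : ℕ → MvPolynomial (Fin (m + 1)) K} (hR : ∀ j, (R j).IsHomogeneous D)
    (i : Fin (m + 1)) :
    specForm m D (fun v : Fin (m + 1) × Fin (veroN m D + 1) => coeff (vexp m D v.2) (R v.1)) i = R i := by
  classical
  rw [specForm]
  conv_rhs => rw [← support_sum_monomial_coeff (R i)]
  symm
  have h2 : ∑ j', monomial (vexp m D j') (coeff (vexp m D j') (R i)) =
      ∑ d ∈ (Finset.univ : Finset (Fin (veroN m D + 1))).image (vexp m D),
        monomial d (coeff d (R i)) := by
    rw [Finset.sum_image fun a _ b _ h => vexp_injective m D h]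
  rw [h2]
  refine Finset.sum_subset ?_ ?_
  · intro d hd
    rw [Finset.mem_image]
    exact ⟨vidx m D d (NguyenRoyK.degree_eq_of_mem_support (hR i) hd), Finset.mem_univ _,
      vexp_vidx m D _ _⟩
  · intro d _ hd
    rw [notMem_support_iff.mp hd, monomial_zero]

/-- Coefficients of `(b ⊗ 1) · r x^α`. [folklore] -/
theorem coeff_map_mul_monomial (f : K →+* L) (b : MvPolynomial (Fin (m + 1)) K)
    (α γ : Fin (m + 1) →₀ ℕ) (r : L) :
    coeff γ (map f b * monomial α r) = r * f (coeff γ (b * monomial α 1)) := by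
  rw [← coeff_map, map_mul, map_monomial, map_one,
    show monomial α r = C r * monomial α 1 by rw [C_mul_monomial, mul_one], mul_left_comm,
    coeff_C_mul]

/-- The polynomial `G_v = ∑_ρ v_ρ · b_{c(ρ)} · Q_{c(ρ).1} ∈ L[x]_ν` represented by a column vector
`v`. [folklore] -/
def Gvec [Algebra K L] (hP : ∀ j, (P j).IsHomogeneous D) (hDν : D ≤ ν)
    (q : Fin (m + 1) × Fin (veroN m D + 1) → L) (v : MonoIdx m ν → L) :
    MvPolynomial (Fin (m + 1)) L :=
  ∑ ρ, v ρ • (map (algebraMap K L) (𝒟.bvec ((colEquiv hP hDν).symm ρ)) *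
    specForm m D q ((colEquiv (𝒟 := 𝒟) hP hDν).symm ρ).1)

/-- `G_v ∈ L[x]_ν`. [folklore] -/
theorem isHomogeneous_Gvec [Algebra K L] (hP : ∀ j, (P j).IsHomogeneous D) (hDν : D ≤ ν)
    (q : Fin (m + 1) × Fin (veroN m D + 1) → L) (v : MonoIdx m ν → L) :
    (Gvec (𝒟 := 𝒟) hP hDν q v).IsHomogeneous ν := by
  refine IsHomogeneous.sum _ _ _ fun ρ _ => ?_
  have h := ((𝒟.isHomogeneous_bvec ((colEquiv hP hDν).symm ρ)).map (algebraMap K L)).mul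
    (isHomogeneous_specForm m D q ((colEquiv (𝒟 := 𝒟) hP hDν).symm ρ).1)
  rw [Nat.sub_add_cancel hDν] at h
  exact (homogeneousSubmodule (Fin (m + 1)) L ν).smul_mem (v ρ) h

/-- **Coefficients of `G_v` are the entries of `M(q) v`**: `[x^γ] G_v = (M(q) v)_γ`.
[cite: Roy2013, proof of Theorem 5.2] -/
theorem coeff_Gvec [Algebra K L] (hP : ∀ j, (P j).IsHomogeneous D) (hDν : D ≤ ν)
    (q : Fin (m + 1) × Fin (veroN m D + 1) → L) (v : MonoIdx m ν → L) (γ : MonoIdx m ν) :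
    coeff γ.1 (Gvec (𝒟 := 𝒟) hP hDν q v) = ((genMat (𝒟 := 𝒟) hP hDν).map (aeval q)).mulVec v γ := by
  simp only [Matrix.mulVec, dotProduct, Matrix.map_apply, genMat, Gvec, coeff_sum, coeff_smul,
    smul_eq_mul]
  refine Finset.sum_congr rfl fun ρ _ => ?_
  rw [genEntry, map_sum, specForm, Finset.mul_sum, coeff_sum, Finset.mul_sum, Finset.sum_mul]
  refine Finset.sum_congr rfl fun j' _ => ?_
  rw [map_mul, aeval_C, aeval_X, coeff_map_mul_monomial]
  ring

/-- `G_v(x) = 0` at a common zero `x` of the `Q_i`. [folklore] -/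
theorem aeval_Gvec_eq_zero [Algebra K L] (hP : ∀ j, (P j).IsHomogeneous D) (hDν : D ≤ ν)
    {q : Fin (m + 1) × Fin (veroN m D + 1) → L} {x : Fin (m + 1) → L}
    (hx : ∀ i, aeval x (specForm m D q i) = 0) (v : MonoIdx m ν → L) :
    aeval x (Gvec (𝒟 := 𝒟) hP hDν q v) = 0 := by
  rw [Gvec, map_sum]
  refine Finset.sum_eq_zero fun ρ _ => ?_
  rw [map_smul, map_mul, hx, mul_zero, smul_zero]

end Spec

/-! ### `Φ(P₀, …, P_m) ≠ 0` -/

/-- **`Φ(P₀, …, P_m) ≠ 0`**: at the coefficient vector of `P` the matrix is that of the isomorphism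
`φ_P` of Lemma 5.1 (injective by the uniqueness of the decomposition). [cite: Roy2013, proof of Theorem 5.2] -/
theorem aeval_coeff_detPhi_ne_zero (hP : ∀ j, (P j).IsHomogeneous D) (hDν : D ≤ ν) :
    aeval (fun v : Fin (m + 1) × Fin (veroN m D + 1) => coeff (vexp m D v.2) (P v.1))
      (detPhi (𝒟 := 𝒟) hP hDν) ≠ 0 := by
  classical
  set qP : Fin (m + 1) × Fin (veroN m D + 1) → K := fun v => coeff (vexp m D v.2) (P v.1) with hqP
  rw [detPhi, AlgHom.map_det, AlgHom.mapMatrix_apply]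
  intro hdet
  obtain ⟨v, hv0, hv⟩ := Matrix.exists_mulVec_eq_zero_iff.mpr hdet
  -- `G_v = 0`
  have hG : Gvec (𝒟 := 𝒟) hP hDν qP v = 0 :=
    eq_zero_of_forall_coeff (isHomogeneous_Gvec hP hDν qP v) fun γ => by
      rw [coeff_Gvec, hv, Pi.zero_apply]
  have hspec : ∀ i, specForm m D qP i = P i := fun i =>
    specForm_coeff (fun j => hP j) i
  -- regroup `G_v = ∑_i (∑_k v_{ik} b_{ik}) P_i`
  set Qv : Fin (m + 1) → MvPolynomial (Fin (m + 1)) K :=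
    fun i => ∑ k : Fin (𝒟.dimE i), v (colEquiv hP hDν ⟨i, k⟩) • 𝒟.bvec ⟨i, k⟩ with hQv
  have hG' : ∑ i, Qv i * P i = 0 := by
    rw [← hG, Gvec, ← Equiv.sum_comp (colEquiv (𝒟 := 𝒟) hP hDν)]
    simp only [Equiv.symm_apply_apply, Algebra.algebraMap_self, map_id, hspec]
    rw [Fintype.sum_sigma]
    refine Finset.sum_congr rfl fun i _ => ?_
    rw [hQv, Finset.sum_mul]
    refine Finset.sum_congr rfl fun k _ => ?_
    rw [smul_mul_assoc]
  have hQmem : ∀ i : Fin (m + 1), Qv i ∈ 𝒟.E i := fun i =>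
    Submodule.sum_mem _ fun k _ => Submodule.smul_mem _ _ (𝒟.bvec_mem ⟨i, k⟩)
  have hu := (𝒟.unique 0 (Submodule.zero_mem _)).unique ⟨hQmem, hG'⟩
    ⟨fun j => Submodule.zero_mem _, by simp⟩
  -- all coefficients vanish
  have hcoef : ∀ (i : Fin (m + 1)) (k : Fin (𝒟.dimE i)), v (colEquiv hP hDν ⟨i, k⟩) = 0 := by
    intro i
    have hi : Qv i = 0 := congrFun hu i
    have hsum : ∑ k : Fin (𝒟.dimE i), v (colEquiv hP hDν ⟨i, k⟩) • 𝒟.basisE i k = 0 := by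
      apply Subtype.ext
      rw [Submodule.coe_sum, Submodule.coe_zero, ← hi, hQv]
      refine Finset.sum_congr rfl fun k _ => ?_
      rw [Submodule.coe_smul]
      rfl
    exact Fintype.linearIndependent_iff.mp (𝒟.basisE i).linearIndependent _ hsum
  apply hv0
  funext ρ
  have := hcoef ((colEquiv hP hDν).symm ρ).1 ((colEquiv hP hDν).symm ρ).2
  rw [Sigma.eta, Equiv.apply_symm_apply] at this
  exact this

/-- **`Φ ≠ 0`.** [cite: Roy2013, proof of Theorem 5.2] -/
theorem detPhi_ne_zero (hP : ∀ j, (P j).IsHomogeneous D) (hDν : D ≤ ν) :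
    detPhi (𝒟 := 𝒟) hP hDν ≠ 0 := fun h =>
  aeval_coeff_detPhi_ne_zero hP hDν (by rw [h, map_zero])

/-! ### `Φ` is multihomogeneous of degree `d_i` in the block `u_i` -/

/-- The entries of column `(j, k)` are linear in the block `u_j` and free of the other blocks.
[cite: Roy2013, proof of Theorem 5.2] -/
theorem isWeightedHomogeneous_genEntry (i : Fin (m + 1)) (γ : Fin (m + 1) →₀ ℕ) (c : 𝒟.ColIdx) :
    IsWeightedHomogeneous (fun v : Fin (m + 1) × Fin (veroN m D + 1) => if v.1 = i then (1 : ℕ) else 0)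
      (𝒟.genEntry γ c) (if c.1 = i then 1 else 0) := by
  refine IsWeightedHomogeneous.sum _ _ _ fun j' _ => ?_
  have h := (isWeightedHomogeneous_C
    (fun v : Fin (m + 1) × Fin (veroN m D + 1) => if v.1 = i then (1 : ℕ) else 0)
    (coeff γ (𝒟.bvec c * monomial (vexp m D j') 1))).mul
    (isWeightedHomogeneous_X K
      (fun v : Fin (m + 1) × Fin (veroN m D + 1) => if v.1 = i then (1 : ℕ) else 0) (c.1, j'))
  rwa [zero_add] at h

/-- `#{columns in block i} = d_i`. [folklore] -/
theorem sum_ite_colEquiv (hP : ∀ j, (P j).IsHomogeneous D) (hDν : D ≤ ν) (i : Fin (m + 1)) :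
    ∑ ρ : MonoIdx m ν, (if ((colEquiv (𝒟 := 𝒟) hP hDν).symm ρ).1 = i then (1 : ℕ) else 0) =
      𝒟.dimE i := by
  rw [← Equiv.sum_comp (colEquiv (𝒟 := 𝒟) hP hDν)]
  simp only [Equiv.symm_apply_apply]
  rw [Fintype.sum_sigma]
  have h : ∀ x : Fin (m + 1), (∑ _y : Fin (𝒟.dimE x), if x = i then (1 : ℕ) else 0) =
      if x = i then 𝒟.dimE x else 0 := by
    intro x
    rw [Finset.sum_const, Finset.card_univ, Fintype.card_fin, smul_eq_mul]
    split_ifs <;> simp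
  exact (Finset.sum_congr rfl fun x _ => h x).trans (by rw [Finset.sum_ite_eq']; simp)

/-- **`Φ` is homogeneous of degree `d_i = dim E_i` in the block `u_i`.** [cite: Roy2013, proof of Theorem 5.2] -/
theorem isWeightedHomogeneous_detPhi (hP : ∀ j, (P j).IsHomogeneous D) (hDν : D ≤ ν) (i : Fin (m + 1)) :
    IsWeightedHomogeneous (fun v : Fin (m + 1) × Fin (veroN m D + 1) => if v.1 = i then (1 : ℕ) else 0)
      (detPhi (𝒟 := 𝒟) hP hDν) (𝒟.dimE i) := by
  classical
  set w : Fin (m + 1) × Fin (veroN m D + 1) → ℕ := fun v => if v.1 = i then (1 : ℕ) else 0 with hw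
  rw [detPhi, Matrix.det_apply]
  refine IsWeightedHomogeneous.sum _ _ _ fun σ _ => ?_
  have hprod : IsWeightedHomogeneous w
      (∏ ρ, genMat (𝒟 := 𝒟) hP hDν (σ ρ) ρ)
      (∑ ρ : MonoIdx m ν, if ((colEquiv (𝒟 := 𝒟) hP hDν).symm ρ).1 = i then 1 else 0) :=
    IsWeightedHomogeneous.prod _ _ _ fun ρ _ => isWeightedHomogeneous_genEntry i _ _
  rw [sum_ite_colEquiv hP hDν i] at hprod
  rw [Units.smul_def]
  have hmem : (∏ ρ, genMat (𝒟 := 𝒟) hP hDν (σ ρ) ρ) ∈ weightedHomogeneousSubmodule K w (𝒟.dimE i) :=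
    hprod
  exact zsmul_mem hmem _

/-- **`deg_{u_i} Φ = d_i`**; in particular `deg_{u_m} Φ = D^m`. [cite: Roy2013, proof of Theorem 5.2] -/
theorem blockDeg_detPhi (hP : ∀ j, (P j).IsHomogeneous D) (hDν : D ≤ ν) (i : Fin (m + 1)) :
    NesterenkoK.blockDeg (detPhi (𝒟 := 𝒟) hP hDν) i = 𝒟.dimE i :=
  NesterenkoK.blockDeg_eq_of_isWeightedHomogeneous (isWeightedHomogeneous_detPhi hP hDν i)
    (detPhi_ne_zero hP hDν)

/-! ### `Res_D ∣ Φ`, through the generic point of `Res_D = 0` -/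

/-- **`Res_D` divides `Φ`** (`char K = 0`, `m ≥ 1`, `D ≥ 2`). At the generic point `ū` of the
hypersurface `Res_D = 0` (in an algebraic closure `L` of `Frac(K[u]/(Res_D))`) the forms `Q_ū` have
a common zero in `ℙ^m(L)` (the zeros theorem for `Res_D`), so `φ_{Q_ū}` is not surjective (it
misses `x_k^ν`), hence `Φ(ū) = det M_{Q_ū} = 0`, i.e. `Φ ∈ (Res_D)`. [cite: Roy2013, proof of Theorem 5.2] -/
theorem resD_dvd_detPhi [CharZero K] (hm : 1 ≤ m) (hD2 : 2 ≤ D) (hP : ∀ j, (P j).IsHomogeneous D)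
    (hDν : D ≤ ν) : resD K m D ∣ detPhi (𝒟 := 𝒟) hP hDν := by
  classical
  have hD : 1 ≤ D := by omega
  -- the prime `Res_D` and the generic point of `Res_D = 0`
  have hprime : Prime (resD K m D) := (irreducible_resD (K := K) hm hD2).prime
  haveI hI : (Ideal.span {resD K m D}).IsPrime := (Ideal.span_singleton_prime hprime.ne_zero).mpr hprime
  set K₀ := MvPolynomial (Fin (m + 1) × Fin (veroN m D + 1)) K ⧸ Ideal.span {resD K m D} with hK₀
  set L := AlgebraicClosure (FractionRing K₀) with hL
  set φ : MvPolynomial (Fin (m + 1) × Fin (veroN m D + 1)) K →ₐ[K] L :=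
    (IsScalarTower.toAlgHom K K₀ L).comp (Ideal.Quotient.mkₐ K (Ideal.span {resD K m D})) with hφ
  have hφapp : ∀ G, φ G = algebraMap K₀ L (Ideal.Quotient.mk (Ideal.span {resD K m D}) G) :=
    fun G => rfl
  have hinjK : Function.Injective (algebraMap K₀ L) := by
    rw [IsScalarTower.algebraMap_eq K₀ (FractionRing K₀) L]
    exact (algebraMap (FractionRing K₀) L).injective.comp (IsFractionRing.injective K₀ (FractionRing K₀))
  have hφdvd : ∀ G, φ G = 0 → resD K m D ∣ G := by
    intro G hG
    rw [hφapp, ← map_zero (algebraMap K₀ L)] at hG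
    have h := hinjK hG
    rw [Ideal.Quotient.eq_zero_iff_mem, Ideal.mem_span_singleton] at h
    exact h
  set u : Fin (m + 1) × Fin (veroN m D + 1) → L := fun v => φ (X v) with hu
  have hφu : ∀ G, φ G = aeval u G := fun G => by
    have key := MvPolynomial.aeval_unique φ
    exact congrFun (congrArg DFunLike.coe key) G
  -- `Res_D(ū) = 0`, so the forms `Q_ū` have a common zero `β`
  have hres : aeval u (resD K m D) = 0 := by
    rw [← hφu, hφapp, Ideal.Quotient.eq_zero_iff_mem.mpr (Ideal.mem_span_singleton_self _), map_zero]
  rw [aeval_resD_eq_zero_iff hm hD2] at hres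
  obtain ⟨x, hx0, hxu⟩ := hres
  have hQ : ∀ i, aeval x (specForm m D u i) = 0 := by
    intro i
    rw [aeval_specForm]
    exact hxu i
  -- hence `Φ(ū) = 0`
  apply hφdvd
  rw [hφu, detPhi, AlgHom.map_det, AlgHom.mapMatrix_apply]
  by_contra hdet
  have hunit : IsUnit ((genMat (𝒟 := 𝒟) hP hDν).map (aeval u)) :=
    (Matrix.isUnit_iff_isUnit_det _).mpr (Ne.isUnit hdet)
  have hsurj := Matrix.mulVec_surjective_iff_isUnit.mpr hunit
  obtain ⟨k, hk⟩ := Function.ne_iff.mp hx0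
  -- the coefficient vector of `x_k^ν`
  obtain ⟨v, hv⟩ := hsurj fun γ => if γ.1 = Finsupp.single k ν then 1 else 0
  have hG : Gvec (𝒟 := 𝒟) hP hDν u v = X k ^ ν := by
    rw [← sub_eq_zero]
    refine eq_zero_of_forall_coeff ((isHomogeneous_Gvec hP hDν u v).sub (isHomogeneous_X_pow _ _))
      fun γ => ?_
    rw [coeff_sub, coeff_Gvec, hv, X_pow_eq_monomial, coeff_monomial, sub_eq_zero]
    dsimp only
    by_cases h : γ.1 = Finsupp.single k ν
    · rw [if_pos h, if_pos h.symm]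
    · rw [if_neg h, if_neg (Ne.symm h)]
  have h0 := aeval_Gvec_eq_zero (𝒟 := 𝒟) hP hDν hQ v
  rw [hG, map_pow, aeval_X] at h0
  exact hk (pow_eq_zero_iff (by omega) |>.mp h0)

/-- **The upper bound `deg 𝔙_D ≤ D^m`**: `Res_D ∣ Φ`, both homogeneous in the block `u_m`, of
degrees `deg 𝔙_D` and `d_m = D^m` (a monomial of `Φ = Res_D Ψ` is a product of monomials).
[cite: Roy2013, proof of Theorem 5.2] -/
theorem ideg_veroIdeal_le_of_decompData [CharZero K] (𝒟 : DecompData K m D ν P) (hm : 1 ≤ m)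
    (hD2 : 2 ≤ D) (hP : ∀ j, (P j).IsHomogeneous D) (hDν : D ≤ ν) :
    NesterenkoK.ideg (veroIdeal K m D) (m + 1) ≤ D ^ m := by
  classical
  obtain ⟨Ψ, hΨ⟩ := resD_dvd_detPhi (𝒟 := 𝒟) hm hD2 hP hDν
  set w : Fin (m + 1) × Fin (veroN m D + 1) → ℕ := fun v => if v.1 = Fin.last m then 1 else 0 with hw
  have hres : IsWeightedHomogeneous w (resD K m D) (NesterenkoK.ideg (veroIdeal K m D) (m + 1)) :=
    NesterenkoK.chowForm_isWeightedHomogeneous (veroIdeal K m D) (Nat.succ_pos m) (Fin.last m)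
  have hphi : IsWeightedHomogeneous w (detPhi (𝒟 := 𝒟) hP hDν) (D ^ m) := by
    rw [← 𝒟.dimE_last]
    exact isWeightedHomogeneous_detPhi hP hDν (Fin.last m)
  by_contra hlt
  rw [not_le] at hlt
  obtain ⟨e, he⟩ := exists_coeff_ne_zero (detPhi_ne_zero (𝒟 := 𝒟) hP hDν)
  have hwe : Finsupp.weight w e = D ^ m := hphi he
  rw [hΨ, coeff_mul] at he
  obtain ⟨⟨a, b⟩, hab, hne⟩ := Finset.exists_ne_zero_of_sum_ne_zero he
  replace hab := Finset.HasAntidiagonal.mem_antidiagonal.mp hab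
  have hwa : Finsupp.weight w a = NesterenkoK.ideg (veroIdeal K m D) (m + 1) :=
    hres (left_ne_zero_of_mul hne)
  have hle : Finsupp.weight w a ≤ Finsupp.weight w e := by
    rw [← hab, map_add]
    exact Nat.le_add_right _ _
  omega

end DecompData

/-- **`deg 𝔙_D = D^m`** over any field of characteristic zero: the resultant `Res_D` of `m + 1`
forms of degree `D` in `m + 1` variables is homogeneous of degree `D^m` in each form
(`m ≥ 1`, `D ≥ 2`). [cite: Roy2013, proof of Theorem 5.2] -/
theorem ideg_veroIdeal_eq [CharZero K] (hm : 1 ≤ m) (hD2 : 2 ≤ D) :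
    NesterenkoK.ideg (veroIdeal K m D) (m + 1) = D ^ m :=
  le_antisymm
    ((purePowData K m D (by omega : 1 ≤ D)).ideg_veroIdeal_le_of_decompData hm hD2
      (NguyenRoy.isHomogeneous_purePow m D) (nuD_spec (m := m) (by omega : 1 ≤ D)).2)
    (pow_le_ideg_veroIdeal hm hD2)

/-- **`deg_{u_i} Res_D = D^m` for every block `u_i`.** [cite: Roy2013, proof of Theorem 5.2] -/
theorem blockDeg_resD_eq [CharZero K] (hm : 1 ≤ m) (hD2 : 2 ≤ D) (i : Fin (m + 1)) :
    NesterenkoK.blockDeg (resD K m D) i = D ^ m := by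
  rw [blockDeg_resD hm hD2, ideg_veroIdeal_eq hm hD2]

end PhiK

end NguyenRoyK

end Literature.NumberTheory.Transcendental
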